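import Summits.Ventures.HodgeRepro2.T7SupportBergmanOneVectorFourier
import Summits.Ventures.HodgeRepro2.T7SupportDenseRegularPoint

/-!
# A dense subset meets the regular non-vanishing locus of the one-vector Fourier coefficient (support, seat p1)

Memo v13 §2g (5) (STATUS l. 15190): «for a regular rational `γ₀ ≠ 1` the GENERAL-F lemma of rows 680/695
(`hF` continuity, `hne = hq_v`) + weak approximation». In the weight-`k` Bergman model the one-vector Fourier
coefficient `Φ_{−(k+2m)}(γ) = c_m(h) ⟨π_k(γ h) zᵐ, 1⟩_k` (`T7SupportBergmanOneVectorFourier.lowestFourierCoeff_eq`)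
is a CONTINUOUS function of `γ` (`continuous_lowestFourierCoeff`: a `K`-finite matrix coefficient composed with
`γ ↦ γ h`) which is non-zero at `γ = 1` as soon as `h ∉ K` (`lowestFourierCoeff_one_ne_zero`); hence row 680's
`exists_mem_dense_ne_zero_kappa_ne_one` applies verbatim: EVERY dense subset `S ⊆ SU(1,1)` contains a `γ₀` with
`Φ_{−(k+2m)}(γ₀) ≠ 0` and `κ(γ₀) ≠ 1` (`exists_mem_dense_regular_lowestFourierCoeff_ne_zero`), i.e. a REGULAR point
where the two-torus orbital integral of the line's one-vector `f` is non-zero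
(`exists_mem_dense_regular_torus_orbital_lowest_ne_zero`) — the model half of «`a_{γ₀} ≠ 0` at a regular rational
`γ₀`» for the declared `f`; what stays in words is that the rational points satisfying the finite-place conditions
form such a dense `S` (weak approximation / Lemma WA′, printed).

Explicit model only; nothing about the adelic group, the global invariant, or any period.
Blind lane: Mathlib + the HodgeRepro2 prefix only; no sorry; axioms ⊆ {propext, Classical.choice, Quot.sound}.
-/

namespace Summit.Ventures.HodgeRepro2.T7SupportBergmanOneVectorRegularPoint

open MeasureTheory Metric
open T5SU11Unimodular T5SU11Fibration T5BergmanCoefficient T5BergmanMatrixCoeff T5HaarCircle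
  T7SupportTwoTorusInvariant T7SupportKappaCartan T7SupportBergmanOneVectorDecay T7SupportBergmanOneVectorFourier
  T7SupportDenseRegularPoint

variable [MeasurableSpace Circle] [BorelSpace Circle]

/-- **the one-vector Fourier coefficient is a continuous function of `γ`** -/
theorem continuous_lowestFourierCoeff (k : ℕ) (hk : 2 ≤ k) (h : SU11) (m : ℕ) :
    Continuous fun γ : SU11 => lowestFourierCoeff k h (-((k + 2 * m : ℕ) : ℤ)) γ := by
  have e : (fun γ : SU11 => lowestFourierCoeff k h (-((k + 2 * m : ℕ) : ℤ)) γ) =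
      fun γ => coherentCoeff k h m * matrixCoeff k (fun w => w ^ m) lowest (γ * h) :=
    funext fun γ => lowestFourierCoeff_eq k hk h m γ
  rw [e]
  exact continuous_const.mul ((continuous_matrixCoeff_monomial k hk m (fun n => if n = 0 then 1 else 0) lowest
    (fun w _ => hasSum_lowest w) (integrableOn_lowest k)).comp (continuous_id.mul continuous_const))

/-- **every dense subset meets the regular non-vanishing locus of `Φ_{−(k+2m)}`** (when `h ∉ K`) -/
theorem exists_mem_dense_regular_lowestFourierCoeff_ne_zero (k : ℕ) (hk : 2 ≤ k) {h : SU11}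
    (hb : mat h 0 1 ≠ 0) (m : ℕ) {S : Set SU11} (hS : Dense S) :
    ∃ γ₀ ∈ S, lowestFourierCoeff k h (-((k + 2 * m : ℕ) : ℤ)) γ₀ ≠ 0 ∧
      kappa (starRingEnd ℂ) dd (colBasis h) (mat γ₀) ≠ 1 :=
  exists_mem_dense_ne_zero_kappa_ne_one h hS (continuous_lowestFourierCoeff k hk h m)
    ⟨1, lowestFourierCoeff_one_ne_zero k hk hb m⟩

/-- **a regular point of a dense subset with non-zero two-torus orbital integral of the line's one-vector `f`**
(first-torus character `u^k`, second-torus character `conj(w^{−(k+2m)})`) -/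
theorem exists_mem_dense_regular_torus_orbital_lowest_ne_zero (k : ℕ) (hk : 2 ≤ k) {h : SU11}
    (hb : mat h 0 1 ≠ 0) (m : ℕ) {S : Set SU11} (hS : Dense S) :
    ∃ γ₀ ∈ S, (∫ u : Circle, ∫ w : Circle, matrixCoeff k lowest lowest (rot u * γ₀ * (h * rot w * h⁻¹)) *
        ((u : ℂ) ^ (k : ℤ) * (starRingEnd ℂ) ((w : ℂ) ^ (-((k + 2 * m : ℕ) : ℤ))))
        ∂haarCircle ∂haarCircle ≠ 0) ∧
      kappa (starRingEnd ℂ) dd (colBasis h) (mat γ₀) ≠ 1 := by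
  obtain ⟨γ₀, hγS, hne, hκ⟩ := exists_mem_dense_regular_lowestFourierCoeff_ne_zero k hk hb m hS
  refine ⟨γ₀, hγS, ?_, hκ⟩
  rw [torus_orbital_lowest_eq k h γ₀ (k : ℤ) (-((k + 2 * m : ℕ) : ℤ)), if_pos rfl, one_mul]
  exact hne

end Summit.Ventures.HodgeRepro2.T7SupportBergmanOneVectorRegularPoint
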